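import Summits.QuantumFields.YangMills.Theorems.PencilRigidityDiagonalMirrorRPRRestated
import Summits.QuantumFields.YangMills.Theorems.PencilRigidityDiagonalMirrorRPRCentreTwistDefs

/-!
# Crux `DiagonalMirrorRPR` (stmt-QuantumFields-10604), line `centre-twisted-swap`: the reduction of the line and the
# restated crux with the weakened sign clause

Crux `DiagonalMirrorRPR` of the routes `PencilRigidity` (#5) and `MirrorModularBoosts` (#4) of `YangMills` (shared verbatim):
for every compact simple `G`, lattice representation `r`, scheme `sch` and one-species family `S₁` with the curvature package
`W₁ r sch S₁` (`CurvaturePackage`), `S₁` is reflection positive in pull-back form in the four diagonal frames (`DiagonalFrameRP`).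

This file is the kernel-checked COMPOSITION of the line `centre-twisted-swap` (tree skeleton
`Cruxes/DiagonalMirrorRPR/Lines/centre_twisted_swap.lean`).  Its first stub S1' (`CentreTwistedSwap.stub_twistedSwapRP`: twisted
swap reflection positivity of Wilson's measure on the Fröhlich–Israel–Lieb–Simon 45° torus at `β ≤ 0` for centre data
`r.ρ z = −𝟙`) is LANDED (`…Theorems.PencilRigidityDiagonalMirrorRPRStubTwistedSwapRP`, lead a2) but is taken here as the HYPOTHESIS
`hS1'` (stated in its registered form), because that module has no farm olean at the time of writing; discharging `hS1'` is the
one-liner `… CentreTwistedSwap.stub_twistedSwapRP`.  The untwisted S1 `ParityBridgeColdTraces.stub_fortyFiveSwapRP` (`β ≥ 0`) is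
used directly:

* `Reduction.exists_coverTwistedSwapRPAt_of_centre` — given S1': for centre data every cover `T̃_N`, `N ≥ 2`, is `Θ'_{z'}`-RP at
  EVERY real coupling for some central `z'` (`z' = 1` when `β ≥ 0`, `z' = z` when `β ≤ 0`).
* `Reduction.diagonalFrameRP_of_centre` — given S1' and the closure statement S4'' (`stub_rpClosureTwisted`, as a hypothesis: the OS-limit
  closure from twisted cover RP), centre data + `W₁` + cover insensitivity give `DiagonalFrameRP S₁` with NO sign clause.
* `Reduction.restatedCruxCentre_of_rpClosureTwisted` — given S1', S4'': the planners' RESTATED crux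
  (`ParityBridgeColdTraces.Reduction.restatedCrux_holds`: `W₁ → (∀ᶠ k, 0 ≤ β_k) → tilted-cover convergence → DiagonalFrameRP`,
  Literature vocabulary `tiltedLatticeSchwinger`) holds with its sign clause WEAKENED to
  `(∃ z ∈ Subgroup.center G, r.ρ z = -1) ∨ ∀ᶠ k in atTop, 0 ≤ sch.β k`, in the binder shape of the route files.
* `Reduction.restatedCruxWeakCoupling_holds` — UNCONDITIONAL: `W₁ → sch.HasWeakCouplingLimit → tilted-cover convergence →
  DiagonalFrameRP` (the Statement's weak-coupling clause as the sign clause of the landed restated crux).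
* `Reduction.DiagonalMirrorRPR_of_transport` — given S1', S4'', the two transport statements T (`stub_coverTransportOffDiag`, shared
  with line `parity-bridge-cold-traces`) and T_c (`stub_coverTransportCentre`) and the scope statement N'
  (`stub_centreBlindNegativeScope`), the crux follows (both route copies).  T / T_c are finite-size (torus → 45° cover)
  transport of Wilson's lattice expectations at physical scale along an arbitrary gapped scheme; no clause of `W₁` mentions the
  cover, so they are inputs of the existence leg, not consequences of `W₁` (leads 0/a1/c1/a2/c2, triage r2-1/r2-2).

No definitions; every hypothesis is stated inline in the registered stub's exact form.  References: Fröhlich–Israel–Lieb–Simon,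
Comm. Math. Phys. 62 (1978) Thm 2.1; FILS II, J. Stat. Phys. 22 (1980) §3; Osterwalder–Schrader, Comm. Math. Phys. 31 (1973)
§2–3; Osterwalder–Seiler, Ann. Phys. 110 (1978) §2; 't Hooft, Nucl. Phys. B153 (1979) 141.
-/

set_option autoImplicit false

noncomputable section

open scoped SchwartzMap
open MeasureTheory Filter Topology
open Literature.MathematicalPhysics.QuantumLattice Literature.MathematicalPhysics.AQFT
  Literature.MathematicalPhysics.QuantumFieldTheory

namespace Summit.QuantumFields.YangMills.Cruxes.DiagonalMirrorRPR.CentreTwistedSwap.Reduction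

open ParityBridgeColdTraces ParityBridgeColdTraces.Reduction

variable {G : Type} [Group G] [TopologicalSpace G] [IsTopologicalGroup G] [CompactSpace G]
  [MeasurableSpace G] [BorelSpace G]

/-! ## §0 The restated crux under the Statement's weak-coupling clause (unconditional)

Since the 2026-08-16 re-type the summit statement `YangMills` carries `sch.HasWeakCouplingLimit` (`β_k → +∞`); threading it
through `HypercubicLimit → CurvatureChannel → W₁` makes every negative-coupling stub of this crux (N', the `β < 0` half of T_c)
vacuous.  The two lemmas below record this: weak coupling gives eventually non-negative couplings, so the landed restated
crux `ParityBridgeColdTraces.Reduction.stub_restatedCrux_closes` applies with `HasWeakCouplingLimit` as its sign clause. -/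

/-- A weak-coupling scheme (`β_k → +∞`) has eventually non-negative couplings. -/
theorem eventually_beta_nonneg_of_hasWeakCouplingLimit {ι : Type} (sch : SpeciesScheme ι)
    (h : sch.HasWeakCouplingLimit) : ∀ᶠ k in atTop, 0 ≤ sch.β k :=
  tendsto_atTop.1 h 0

/-- **The restated crux under the weak-coupling clause of the Statement** (unconditional, binder shape of the route files):
for every compact simple `G`, `r`, `sch`, `S₁`, the curvature package `W₁`, `sch.HasWeakCouplingLimit` and convergence of the
renormalised curvature strings to `S₁` on `⁰𝒮` along the 45° covers (`tiltedLatticeSchwinger`) imply reflection positivity of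
`S₁` in pull-back form in the four diagonal frames. -/
theorem restatedCruxWeakCoupling_holds :
    ∀ (G : Type) [Group G] [TopologicalSpace G] [IsTopologicalGroup G] [CompactSpace G],
      IsCompactSimpleLieGroup G →
        letI : MeasurableSpace G := borel G
        haveI : BorelSpace G := ⟨rfl⟩
        ∀ (r : LatticeRep G) (sch : SpeciesScheme (YMSpecies G)) (S₁ : SchwingerFamily E4),
          CurvaturePackage r sch S₁ → sch.HasWeakCouplingLimit →
            (∀ (n : ℕ), n ≠ 0 → ∀ (f : Fin n → 𝓢(E4, ℝ)) (F : 𝓢((Fin n → E4), ℂ)),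
              IsTensorOf F (fun i => ofRealTest (f i)) → IsOffDiagonal F →
                Tendsto (fun k : ℕ =>
                  ((tiltedLatticeSchwinger r.ρ sch (fun s => s.F) k n (fun _ => r.curvature) f : ℝ) : ℂ))
                  atTop (𝓝 (S₁ n F))) →
              DiagonalFrameRP S₁ := by
  intro G _ _ _ _ hG
  letI : MeasurableSpace G := borel G
  haveI : BorelSpace G := ⟨rfl⟩
  intro r sch S₁ hW hwc hcc
  exact stub_restatedCrux_closes G hG r sch S₁ hW (eventually_beta_nonneg_of_hasWeakCouplingLimit sch hwc) hcc

/-! ## §1 Cover reflection positivity at every coupling for centre data (modulo S1') -/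

/-- **Cover RP at every coupling for centre data.**  For `(G, r)` with a central `z`, `r.ρ z = −𝟙`: every cover `T̃_N`,
`N ≥ 2`, is `Θ'_{z'}`-reflection positive at every real `β` for some central `z'` — the trivial twist (`Θ'_1 = θ^*`, the
landed S1 `stub_fortyFiveSwapRP`) when `β ≥ 0`, the centre twist `Θ'_z` (S1', hypothesis `hS1'`) when `β ≤ 0`. -/
theorem exists_coverTwistedSwapRPAt_of_centre
    (hS1' : ∀ (G : Type) [Group G] [TopologicalSpace G] [IsTopologicalGroup G] [CompactSpace G]
      [MeasurableSpace G] [BorelSpace G] (Nc : ℕ) (ρ : G →* Matrix (Fin Nc) (Fin Nc) ℂ),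
      Continuous ρ → (∀ g, ρ g ∈ Matrix.unitaryGroup (Fin Nc) ℂ) →
        ∀ z ∈ Subgroup.center G, ρ z = -1 →
          ∀ (β : ℝ), β ≤ 0 → ∀ (N : ℕ) [NeZero N], 2 ≤ N → CoverTwistedSwapRPAt ρ z β N)
    (r : LatticeRep G) {z : G} (hz : z ∈ Subgroup.center G)
    (hρz : r.ρ z = -1) (β : ℝ) (N : ℕ) [NeZero N] (hN : 2 ≤ N) :
    ∃ z' ∈ Subgroup.center G, CoverTwistedSwapRPAt r.ρ z' β N := by
  rcases le_total β 0 with hβ | hβ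
  · exact ⟨z, hz, hS1' G r.N r.ρ r.continuous r.mem_unitary z hz hρz β hβ N hN⟩
  · exact ⟨1, Subgroup.one_mem _, (coverTwistedSwapRPAt_one_iff r.ρ β N).2
      (stub_fortyFiveSwapRP G r.N r.ρ r.continuous r.mem_unitary β hβ N hN)⟩

/-- Along a scheme: for centre data the twisted cover-RP input of the closure S4'' holds at every step with `side ≥ 2`,
whatever the signs of the couplings `β_k`. -/
theorem coverTwistedRP_along_scheme_of_centre
    (hS1' : ∀ (G : Type) [Group G] [TopologicalSpace G] [IsTopologicalGroup G] [CompactSpace G]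
      [MeasurableSpace G] [BorelSpace G] (Nc : ℕ) (ρ : G →* Matrix (Fin Nc) (Fin Nc) ℂ),
      Continuous ρ → (∀ g, ρ g ∈ Matrix.unitaryGroup (Fin Nc) ℂ) →
        ∀ z ∈ Subgroup.center G, ρ z = -1 →
          ∀ (β : ℝ), β ≤ 0 → ∀ (N : ℕ) [NeZero N], 2 ≤ N → CoverTwistedSwapRPAt ρ z β N)
    (r : LatticeRep G) (sch : SpeciesScheme (YMSpecies G)) {z : G}
    (hz : z ∈ Subgroup.center G) (hρz : r.ρ z = -1) :
    ∀ k, 2 ≤ sch.side k → ∃ z' ∈ Subgroup.center G, CoverTwistedSwapRPAt r.ρ z' (sch.β k) (sch.side k) :=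
  fun k hk => exists_coverTwistedSwapRPAt_of_centre hS1' r hz hρz (sch.β k) (sch.side k) hk

/-! ## §2 The centre branch and the restated crux with the weakened sign clause (modulo S1' and the closure S4'') -/

section Closure

/- S1' (`stub_twistedSwapRP`, registered, landed by lead a2) and the closure statement S4'' of the line (`stub_rpClosureTwisted`,
registered): twisted cover reflection positivity and the OS-limit closure from it, no sign clause.  Taken as the hypotheses
`hS1'`, `hS4''` throughout this section. -/
variable
  (hS1' : ∀ (G : Type) [Group G] [TopologicalSpace G] [IsTopologicalGroup G] [CompactSpace G]
      [MeasurableSpace G] [BorelSpace G] (Nc : ℕ) (ρ : G →* Matrix (Fin Nc) (Fin Nc) ℂ),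
      Continuous ρ → (∀ g, ρ g ∈ Matrix.unitaryGroup (Fin Nc) ℂ) →
        ∀ z ∈ Subgroup.center G, ρ z = -1 →
          ∀ (β : ℝ), β ≤ 0 → ∀ (N : ℕ) [NeZero N], 2 ≤ N → CoverTwistedSwapRPAt ρ z β N)
  (hS4'' : ∀ (G : Type) [Group G] [TopologicalSpace G] [IsTopologicalGroup G] [CompactSpace G]
      [MeasurableSpace G] [BorelSpace G], IsCompactSimpleLieGroup G →
      ∀ (r : LatticeRep G) (sch : SpeciesScheme (YMSpecies G)) (S₁ : SchwingerFamily E4),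
        CurvaturePackage r sch S₁ →
          (∀ k, 2 ≤ sch.side k → ∃ z ∈ Subgroup.center G, CoverTwistedSwapRPAt r.ρ z (sch.β k) (sch.side k)) →
            CoverInsensitivityOffDiag r sch → DiagonalFrameRP S₁)
include hS1' hS4''

/-- **The centre branch.**  Given S1' and S4'': for centre data, the curvature package and cover insensitivity (off-diagonal) give
`DiagonalFrameRP S₁` with NO sign clause on the couplings (S1/S1' per step via `coverTwistedRP_along_scheme_of_centre`). -/
theorem diagonalFrameRP_of_centre (hG : IsCompactSimpleLieGroup G) (r : LatticeRep G) (sch : SpeciesScheme (YMSpecies G))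
    (S₁ : SchwingerFamily E4) (hW : CurvaturePackage r sch S₁) (hz : ∃ z ∈ Subgroup.center G, r.ρ z = -1)
    (hCI : CoverInsensitivityOffDiag r sch) : DiagonalFrameRP S₁ := by
  obtain ⟨z, hzc, hρz⟩ := hz
  exact hS4'' G hG r sch S₁ hW (coverTwistedRP_along_scheme_of_centre hS1' r sch hzc hρz) hCI

/-- **Closing theorem with the weakened sign clause (cover vocabulary of the line).**  Given S1' and S4'': the curvature package, the
sign clause `(∃ z ∈ Z(G), r.ρ z = −𝟙) ∨ ∀ᶠ k, 0 ≤ β_k` and lattice convergence of the curvature strings on the 45° covers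
(`coverSchwinger`) imply `DiagonalFrameRP S₁` — the centre disjunct by `diagonalFrameRP_of_centre`, the sign disjunct by the
landed `ParityBridgeColdTraces.Reduction.diagonalFrameRP_of_coverConvergence`. -/
theorem diagonalFrameRP_of_coverConvergence_centre (hG : IsCompactSimpleLieGroup G) (r : LatticeRep G)
    (sch : SpeciesScheme (YMSpecies G)) (S₁ : SchwingerFamily E4) (hW : CurvaturePackage r sch S₁)
    (hsign : (∃ z ∈ Subgroup.center G, r.ρ z = -1) ∨ ∀ᶠ k in atTop, 0 ≤ sch.β k)
    (hcc : ∀ (n : ℕ), n ≠ 0 → ∀ (f : Fin n → 𝓢(E4, ℝ)) (F : 𝓢((Fin n → E4), ℂ)),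
      IsTensorOf F (fun i => ofRealTest (f i)) → IsOffDiagonal F →
        Tendsto (fun k : ℕ => ((coverSchwinger r sch k n f : ℝ) : ℂ)) atTop (𝓝 (S₁ n F))) :
    DiagonalFrameRP S₁ := by
  rcases hsign with hz | hev
  · exact diagonalFrameRP_of_centre hS1' hS4'' hG r sch S₁ hW hz (coverInsensitivityOffDiag_of_coverConvergence r sch S₁ hW hcc)
  · exact diagonalFrameRP_of_coverConvergence hG r sch S₁ hW hev hcc

/-- **The restated crux with the WEAKENED sign clause, in Literature vocabulary and in the binder shape of the route files**
(`MeasurableSpace G := borel G`), modulo S1' and S4''.  For every compact simple `G`, `r`, `sch`, `S₁`: the curvature package `W₁`,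
the sign clause `(∃ z ∈ Subgroup.center G, r.ρ z = -1) ∨ ∀ᶠ k in atTop, 0 ≤ sch.β k`, and convergence of the renormalised
curvature strings to `S₁` on `⁰𝒮` along the 45° covers `T̃_{2L_k+1}` (`tiltedLatticeSchwinger`) imply reflection positivity of
`S₁` in pull-back form in the four diagonal frames.  With the stronger clause `∀ᶠ k, 0 ≤ sch.β k` alone this is the landed
`ParityBridgeColdTraces.Reduction.restatedCrux_holds` (unconditional). -/
theorem restatedCruxCentre_of_rpClosureTwisted :
    ∀ (G : Type) [Group G] [TopologicalSpace G] [IsTopologicalGroup G] [CompactSpace G],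
      IsCompactSimpleLieGroup G →
        letI : MeasurableSpace G := borel G
        haveI : BorelSpace G := ⟨rfl⟩
        ∀ (r : LatticeRep G) (sch : SpeciesScheme (YMSpecies G)) (S₁ : SchwingerFamily E4),
          CurvaturePackage r sch S₁ →
            ((∃ z ∈ Subgroup.center G, r.ρ z = -1) ∨ ∀ᶠ k in atTop, 0 ≤ sch.β k) →
              (∀ (n : ℕ), n ≠ 0 → ∀ (f : Fin n → 𝓢(E4, ℝ)) (F : 𝓢((Fin n → E4), ℂ)),
                IsTensorOf F (fun i => ofRealTest (f i)) → IsOffDiagonal F →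
                  Tendsto (fun k : ℕ =>
                    ((tiltedLatticeSchwinger r.ρ sch (fun s => s.F) k n (fun _ => r.curvature) f : ℝ) : ℂ))
                    atTop (𝓝 (S₁ n F))) →
                DiagonalFrameRP S₁ := by
  intro G _ _ _ _ hG
  letI : MeasurableSpace G := borel G
  haveI : BorelSpace G := ⟨rfl⟩
  intro r sch S₁ hW hsign hcc
  refine diagonalFrameRP_of_coverConvergence_centre hS1' hS4'' hG r sch S₁ hW hsign fun n hn f F hT hO => ?_
  simpa only [coverSchwinger_eq_tiltedLatticeSchwinger] using hcc n hn f F hT hO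

/-! ## §3 The composition of the line: S4'' + transport (T, T_c) + scope (N') ⇒ the crux -/

/-- **The line concludes the crux** (`PencilRigidity` copy, by name), modulo S1', S4'' and the three statements the line does NOT
prove: T (`stub_coverTransportOffDiag`: cover transport for eventually non-negative couplings, shared with line
`parity-bridge-cold-traces`), T_c (`stub_coverTransportCentre`: cover transport for centre data, all signs) and the scope N'
(`stub_centreBlindNegativeScope`: centre-blind data with `β_k < 0` frequently).  Case split: centre data → T_c then
`diagonalFrameRP_of_centre`; centre-blind with `β_k ≥ 0` eventually → T then the landed
`ParityBridgeColdTraces.Reduction.diagonalFrameRP_of_coverInsensitivityOffDiag`; centre-blind with `β_k < 0` frequently → N'. -/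
theorem DiagonalMirrorRPR_of_transport
    (hT : ∀ (G : Type) [Group G] [TopologicalSpace G] [IsTopologicalGroup G] [CompactSpace G]
      [MeasurableSpace G] [BorelSpace G], IsCompactSimpleLieGroup G →
      ∀ (r : LatticeRep G) (sch : SpeciesScheme (YMSpecies G)) (S₁ : SchwingerFamily E4),
        CurvaturePackage r sch S₁ → (∀ᶠ k in atTop, 0 ≤ sch.β k) → CoverInsensitivityOffDiag r sch)
    (hTc : ∀ (G : Type) [Group G] [TopologicalSpace G] [IsTopologicalGroup G] [CompactSpace G]
      [MeasurableSpace G] [BorelSpace G], IsCompactSimpleLieGroup G →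
      ∀ (r : LatticeRep G) (sch : SpeciesScheme (YMSpecies G)) (S₁ : SchwingerFamily E4),
        CurvaturePackage r sch S₁ → (∃ z ∈ Subgroup.center G, r.ρ z = -1) → CoverInsensitivityOffDiag r sch)
    (hN : ∀ (G : Type) [Group G] [TopologicalSpace G] [IsTopologicalGroup G] [CompactSpace G]
      [MeasurableSpace G] [BorelSpace G], IsCompactSimpleLieGroup G →
      ∀ (r : LatticeRep G) (sch : SpeciesScheme (YMSpecies G)) (S₁ : SchwingerFamily E4),
        CurvaturePackage r sch S₁ → (¬ ∃ z ∈ Subgroup.center G, r.ρ z = -1) → (∃ᶠ k in atTop, sch.β k < 0) →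
          DiagonalFrameRP S₁) :
    Summit.QuantumFields.YangMills.Theses.PencilRigidity.DiagonalMirrorRPR := by
  -- readback: the decl is definitionally `∀ G simple, r, sch, S₁: CurvaturePackage → DiagonalFrameRP`
  have hiff : Summit.QuantumFields.YangMills.Theses.PencilRigidity.DiagonalMirrorRPR ↔
      ∀ (G : Type) [Group G] [TopologicalSpace G] [IsTopologicalGroup G] [CompactSpace G],
        IsCompactSimpleLieGroup G →
          letI : MeasurableSpace G := borel G
          haveI : BorelSpace G := ⟨rfl⟩
          ∀ (r : LatticeRep G) (sch : SpeciesScheme (YMSpecies G)) (S₁ : SchwingerFamily E4),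
            CurvaturePackage r sch S₁ → DiagonalFrameRP S₁ := Iff.rfl
  refine hiff.mpr ?_
  intro G _ _ _ _ hG
  letI : MeasurableSpace G := borel G
  haveI : BorelSpace G := ⟨rfl⟩
  intro r sch S₁ hW
  by_cases hz : ∃ z ∈ Subgroup.center G, r.ρ z = -1
  · exact diagonalFrameRP_of_centre hS1' hS4'' hG r sch S₁ hW hz (hTc G hG r sch S₁ hW hz)
  · by_cases hev : ∀ᶠ k in atTop, 0 ≤ sch.β k
    · exact diagonalFrameRP_of_coverInsensitivityOffDiag hG r sch S₁ hW hev (hT G hG r sch S₁ hW hev)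
    · have hneg : ∃ᶠ k in atTop, sch.β k < 0 := by
        simpa only [Filter.not_eventually, not_le] using hev
      exact hN G hG r sch S₁ hW hz hneg

/-- The same composition for the item's recorded decl, the `MirrorModularBoosts` copy (shared VERBATIM with the
`PencilRigidity` copy: the two are the same proposition). -/
theorem DiagonalMirrorRPR_mmb_of_transport
    (hT : ∀ (G : Type) [Group G] [TopologicalSpace G] [IsTopologicalGroup G] [CompactSpace G]
      [MeasurableSpace G] [BorelSpace G], IsCompactSimpleLieGroup G →
      ∀ (r : LatticeRep G) (sch : SpeciesScheme (YMSpecies G)) (S₁ : SchwingerFamily E4),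
        CurvaturePackage r sch S₁ → (∀ᶠ k in atTop, 0 ≤ sch.β k) → CoverInsensitivityOffDiag r sch)
    (hTc : ∀ (G : Type) [Group G] [TopologicalSpace G] [IsTopologicalGroup G] [CompactSpace G]
      [MeasurableSpace G] [BorelSpace G], IsCompactSimpleLieGroup G →
      ∀ (r : LatticeRep G) (sch : SpeciesScheme (YMSpecies G)) (S₁ : SchwingerFamily E4),
        CurvaturePackage r sch S₁ → (∃ z ∈ Subgroup.center G, r.ρ z = -1) → CoverInsensitivityOffDiag r sch)
    (hN : ∀ (G : Type) [Group G] [TopologicalSpace G] [IsTopologicalGroup G] [CompactSpace G]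
      [MeasurableSpace G] [BorelSpace G], IsCompactSimpleLieGroup G →
      ∀ (r : LatticeRep G) (sch : SpeciesScheme (YMSpecies G)) (S₁ : SchwingerFamily E4),
        CurvaturePackage r sch S₁ → (¬ ∃ z ∈ Subgroup.center G, r.ρ z = -1) → (∃ᶠ k in atTop, sch.β k < 0) →
          DiagonalFrameRP S₁) :
    Summit.QuantumFields.YangMills.Theses.MirrorModularBoosts.DiagonalMirrorRPR := by
  have h : Summit.QuantumFields.YangMills.Theses.PencilRigidity.DiagonalMirrorRPR ↔
      Summit.QuantumFields.YangMills.Theses.MirrorModularBoosts.DiagonalMirrorRPR := Iff.rfl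
  exact h.mp (DiagonalMirrorRPR_of_transport hS1' hS4'' hT hTc hN)

end Closure

/-! ## §4 Registered sub-goals of the item (verbatim one-line headers; `ledger workitem stub-add`) -/

/-- **Registered sub-goal `stub_restatedCruxWeakCoupling_closes`** (UNCONDITIONAL): the restated crux with the Statement's
weak-coupling clause as its sign clause — `W₁ → sch.HasWeakCouplingLimit → tilted-cover convergence → DiagonalFrameRP S₁`
(`restatedCruxWeakCoupling_holds` with explicit measurable-space binders). -/
theorem stub_restatedCruxWeakCoupling_closes : ∀ (G : Type) [Group G] [TopologicalSpace G] [IsTopologicalGroup G] [CompactSpace G] [MeasurableSpace G] [BorelSpace G], IsCompactSimpleLieGroup G → ∀ (r : LatticeRep G) (sch : SpeciesScheme (YMSpecies G)) (S₁ : SchwingerFamily E4), CurvaturePackage r sch S₁ → sch.HasWeakCouplingLimit → (∀ (n : ℕ), n ≠ 0 → ∀ (f : Fin n → 𝓢(E4, ℝ)) (F : 𝓢((Fin n → E4), ℂ)), IsTensorOf F (fun i => ofRealTest (f i)) → IsOffDiagonal F → Tendsto (fun k : ℕ => ((tiltedLatticeSchwinger r.ρ sch (fun s => s.F) k n (fun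 _ => r.curvature) f : ℝ) : ℂ)) atTop (𝓝 (S₁ n F))) → DiagonalFrameRP S₁ :=
  fun G _ _ _ _ _ _ hG r sch S₁ hW hwc hcc =>
    stub_restatedCrux_closes G hG r sch S₁ hW (eventually_beta_nonneg_of_hasWeakCouplingLimit sch hwc) hcc

/-- **Registered sub-goal `stub_restatedCruxCentreTwisted_closes`** (modulo S1' and S4'', its first two hypotheses): the restated
crux with the WEAKENED sign clause `(∃ z ∈ Subgroup.center G, r.ρ z = -1) ∨ ∀ᶠ k in atTop, 0 ≤ sch.β k`
(`restatedCruxCentre_of_rpClosureTwisted` with explicit measurable-space binders). -/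
theorem stub_restatedCruxCentreTwisted_closes : (∀ (G : Type) [Group G] [TopologicalSpace G] [IsTopologicalGroup G] [CompactSpace G] [MeasurableSpace G] [BorelSpace G] (Nc : ℕ) (ρ : G →* Matrix (Fin Nc) (Fin Nc) ℂ), Continuous ρ → (∀ g, ρ g ∈ Matrix.unitaryGroup (Fin Nc) ℂ) → ∀ z ∈ Subgroup.center G, ρ z = -1 → ∀ (β : ℝ), β ≤ 0 → ∀ (N : ℕ) [NeZero N], 2 ≤ N → CoverTwistedSwapRPAt ρ z β N) → (∀ (G : Type) [Group G] [TopologicalSpace G] [IsTopologicalGroup G] [CompactSpace G] [MeasurableSpace G] [BorelSpace G], IsCompactSimpleLieGroup G → ∀ (r : LatticeRep G) (sch : SpeciesScheme (YMSpecies G)) (S₁ : SchwingerFamily E4), CurvaturePackage r sch S₁ → (∀ k, 2 ≤ sch.side k → ∃ z ∈ Subgroup.center G, CoverTwistedSwapRPAt r.ρ z (sch.β k) (sch.side k)) → CoverInsensitivityOffDiag r sch → DiagonalFrameRP S₁) → ∀ (G : Type) [Group G] [TopologicalSpace G] [IsTopologicalGroup G] [CompactSpace G] [MeasurableSpace G]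 [BorelSpace G], IsCompactSimpleLieGroup G → ∀ (r : LatticeRep G) (sch : SpeciesScheme (YMSpecies G)) (S₁ : SchwingerFamily E4), CurvaturePackage r sch S₁ → ((∃ z ∈ Subgroup.center G, r.ρ z = -1) ∨ ∀ᶠ k in atTop, 0 ≤ sch.β k) → (∀ (n : ℕ), n ≠ 0 → ∀ (f : Fin n → 𝓢(E4, ℝ)) (F : 𝓢((Fin n → E4), ℂ)), IsTensorOf F (fun i => ofRealTest (f i)) → IsOffDiagonal F → Tendsto (fun k : ℕ => ((tiltedLatticeSchwinger r.ρ sch (fun s => s.F) k n (fun _ => r.curvature) f : ℝ) : ℂ)) atTop (𝓝 (S₁ n F))) → DiagonalFrameRP S₁ :=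
  fun hS1' hS4'' G _ _ _ _ _ _ hG r sch S₁ hW hsign hcc =>
    diagonalFrameRP_of_coverConvergence_centre hS1' hS4'' hG r sch S₁ hW hsign fun n hn f F hT hO => by
      simpa only [coverSchwinger_eq_tiltedLatticeSchwinger] using hcc n hn f F hT hO

/-- **Registered sub-goal `stub_centreTwistedReduction_transport`** (the composition of the line `centre-twisted-swap`):
S1' → S4'' → T → T_c → N' → the crux (the item's recorded decl, the `MirrorModularBoosts` copy). -/
theorem stub_centreTwistedReduction_transport : (∀ (G : Type) [Group G] [TopologicalSpace G] [IsTopologicalGroup G] [CompactSpace G] [MeasurableSpace G] [BorelSpace G] (Nc : ℕ) (ρ : G →* Matrix (Fin Nc) (Fin Nc) ℂ), Continuous ρ → (∀ g, ρ g ∈ Matrix.unitaryGroup (Fin Nc) ℂ) → ∀ z ∈ Subgroup.center G, ρ z = -1 → ∀ (β : ℝ), β ≤ 0 → ∀ (N : ℕ) [NeZero N], 2 ≤ N → CoverTwistedSwapRPAt ρ z β N) → (∀ (G : Type) [Group G] [TopologicalSpace G] [IsTopologicalGroup G] [CompactSpace G] [MeasurableSpace G] [BorelSpace G], IsCompactSimpleLieGroup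 G → ∀ (r : LatticeRep G) (sch : SpeciesScheme (YMSpecies G)) (S₁ : SchwingerFamily E4), CurvaturePackage r sch S₁ → (∀ k, 2 ≤ sch.side k → ∃ z ∈ Subgroup.center G, CoverTwistedSwapRPAt r.ρ z (sch.β k) (sch.side k)) → CoverInsensitivityOffDiag r sch → DiagonalFrameRP S₁) → (∀ (G : Type) [Group G] [TopologicalSpace G] [IsTopologicalGroup G] [CompactSpace G] [MeasurableSpace G] [BorelSpace G], IsCompactSimpleLieGroup G → ∀ (r : LatticeRep G) (sch : SpeciesScheme (YMSpecies G)) (S₁ : SchwingerFamily E4), CurvaturePackage r sch S₁ → (∀ᶠ k in atTop, 0 ≤ sch.β k) → CoverInsensitivityOffDiag r sch) → (∀ (G : Type) [Group G] [TopologicalSpace G] [IsTopologicalGroup G] [CompactSpace G] [MeasurableSpace G] [BorelSpace G], IsCompactSimpleLieGroup G → ∀ (r : LatticeRep G) (sch : SpeciesScheme (YMSpecies G)) (S₁ : SchwingerFamily E4), CurvaturePackage r sch S₁ → (∃ z ∈ Subgroup.center G, r.ρ z = -1) → CoverInsensitivityOffDiag r sch) → (∀ (G : Type) [Group G] [TopologicalSpace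 G] [IsTopologicalGroup G] [CompactSpace G] [MeasurableSpace G] [BorelSpace G], IsCompactSimpleLieGroup G → ∀ (r : LatticeRep G) (sch : SpeciesScheme (YMSpecies G)) (S₁ : SchwingerFamily E4), CurvaturePackage r sch S₁ → (¬ ∃ z ∈ Subgroup.center G, r.ρ z = -1) → (∃ᶠ k in atTop, sch.β k < 0) → DiagonalFrameRP S₁) → Summit.QuantumFields.YangMills.Theses.MirrorModularBoosts.DiagonalMirrorRPR :=
  fun hS1' hS4'' hT hTc hN => DiagonalMirrorRPR_mmb_of_transport hS1' hS4'' hT hTc hN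

end Summit.QuantumFields.YangMills.Cruxes.DiagonalMirrorRPR.CentreTwistedSwap.Reduction

end
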